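import Summits.Parity.GeneralizedHardyLittlewood.Theorems.PrimeLevelFamEdgeMomentsBeyondDiagonalDiagDecorM4Collapse
import HarnessLib

/-!
# Route `PrimeLevelFamEdge`, crux K_A `MomentsBeyondDiagonal` (stmt-Parity-20007), line «petersson_layers» v4, stub `stub_diag`:
# **the GENERIC crude collapse with a `(1+κ)`-weighted coordinate: the `(log g)^t` pieces of a shifted block whose two
# coordinates have crude sizes `K₁D(n)(1+κ(n))log^{a₁}M` and `K₂D(n)log^{a₂}M` are `O(log^{t+q+a₁+a₂+1}M)` for EVERY `t ≥ 0`**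

The abstract form of `…DiagDecorM4Collapse` (there: the `M₄`-coordinate against the undecorated coordinate `𝒮^{[r₂]}`): here the
two coordinates `S₁ M n`, `S₂ M n` are ARBITRARY functions with the displayed crude sizes — the `(1+κ)`-weighted one is the
`M₄`-coordinate of `…DiagDecorM4Coord.abs_shiftedCoordM4_le` (`a₁ = r₁ + 1`, no main term), the plain one any profile coordinate
(`…DiagDecorLogGMonomial.abs_profileCoord_crude_le`, e.g. the `P₂`-coordinate, `a₂ = r₂`). Every piece
`Σ_cΣ_g μ(g)c·log^tg·W(cg)²·B(cg)^q·S₁(cg)·S₂(cg)` (`B(n) = λlog M − log(M/n)`, `|B| ≤ log M`) is bounded crudely: for `t ≥ 1` by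
`…DecorCollapseBounds.abs_selbergCollapse_logPow_le`, `1 + κ(n) ≤ 2 log M` and `Σ_{n≤N}κ(n)D(n)²/n ≤ 48A(2+log N)`; for `t = 0` by
`Σ_{g∣n}μ(g)(n/g) = φ(n)`, `φ(n)W(n)² ≤ 1/n` and `Σ_{n≤N}(1+κ(n))D(n)²/n ≤ 49A(2+log N)`:

* `abs_collapseKappaCrude_logPow_le` — `t ≥ 1`;  * `abs_collapseKappaCrude_zero_le` — `t = 0`;
* `abs_collapseKappaCrude_le` — **every `t`: `|piece_t| ≤ C·log^{t+q+a₁+a₂+1}M`** (`M ≥ 3`, `0 ≤ λ ≤ 1`).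

This is the collapse layer of the two-sided crude blocks `M₄ ⊗ P₂` (rung 3, hypothesis (M4P2) of
`…DiagDecorOrderThreeThreePoly.orderThreeThreePoly_of_M4P2` and of order `(2,4)`), `M₆ ⊗ P₂`, `M₄ ⊗ M₄` (rung 4). Def-free;
theorems only. Helper `--supports stmt-Parity-20007`; closes nothing; K_A, K_B and the Parity summit are NOT proved; nothing about
Landau–Siegel zeros.

## References
* E. Kowalski, P. Michel, J. VanderKam, J. reine angew. Math. 526 (2000), (23)–(28) pp. 13–15 and Prop. 5.1 p. 18.
  [cite: KowalskiMichelVanderKam2000, (23)–(28) — derivation (log g terms of the diagonal weight, crude two-sided blocks)]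
-/

noncomputable section

open scoped Real ArithmeticFunction.Moebius
open Finset ArithmeticFunction Polynomial

namespace Summit.Parity.GeneralizedHardyLittlewood.Theorems.MomentsBeyondDiagonal.DiagKernel

open Literature.NumberTheory.LFunctions Literature.NumberTheory.LFunctions.KMV2000
open MollifierMainTerm (W)
open SelbergCoord (kappa)
open Literature.NumberTheory.Sieve (one_le_log_of_three_le)
open Summit.Parity.GeneralizedHardyLittlewood.Theorems.BeyondDiagonalBeatsQuarter.KernelFormXSq
  (divWeight divWeight_nonneg abs_W_le totient_mul_W_sq_le sum_kappa_divWeight_sq_div_le sum_divWeight_sq_div_le)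

variable (S₁ S₂ : ℝ → ℕ → ℝ) (a₁ a₂ : ℕ)

/-- `κ(n) ≥ 0`. [folklore] -/
private theorem kappa_nonneg₇ (n : ℕ) : 0 ≤ kappa n := by
  unfold kappa
  exact Finset.sum_nonneg fun p hp ↦ by
    have hp2 : (2 : ℝ) ≤ p := by exact_mod_cast (Nat.prime_of_mem_primeFactors hp).two_le
    exact div_nonneg (Real.log_nonneg (by linarith)) (by linarith)

/-- **The `(log g)^t` pieces, `t ≥ 1`, of a shifted block with a `(1+κ)`-weighted crude coordinate and a plain crude
coordinate are `O(log^{t+q+a₁+a₂+1}M)`.** [cite: KowalskiMichelVanderKam2000, (23)–(28) — derivation] -/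
theorem abs_collapseKappaCrude_logPow_le {K₁ K₂ : ℝ} (hK₁ : 0 ≤ K₁) (hK₂ : 0 ≤ K₂)
    (hb₁ : ∀ M : ℝ, 3 ≤ M → ∀ n : ℕ, n ≠ 0 → (n : ℝ) ≤ M →
      |S₁ M n| ≤ K₁ * divWeight n * (1 + kappa n) * Real.log M ^ a₁)
    (hb₂ : ∀ M : ℝ, 3 ≤ M → ∀ n : ℕ, n ≠ 0 → (n : ℝ) ≤ M →
      |S₂ M n| ≤ K₂ * divWeight n * Real.log M ^ a₂)
    {t : ℕ} (ht : 1 ≤ t) (q : ℕ) {lam : ℝ} (hlam0 : 0 ≤ lam) (hlam1 : lam ≤ 1) :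
    ∃ C : ℝ, 0 < C ∧ ∀ M : ℝ, 3 ≤ M →
      |∑ c ∈ Icc 1 ⌊M⌋₊, ∑ g ∈ Icc 1 (⌊M⌋₊ / c), (μ g : ℝ) * c * Real.log g ^ t * (W (c * g) ^ 2 *
          ((lam * Real.log M - Real.log (M / ((c * g : ℕ) : ℝ))) ^ q * S₁ M (c * g) * S₂ M (c * g)))| ≤
        C * Real.log M ^ (t + q + a₁ + a₂ + 1) := by
  set A : ℝ := (∑' d : ℕ, (d : ℝ) ^ (-(5 / 4 : ℝ))) ^ 2 with hA
  have hA0 : 0 ≤ A := by positivity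
  refine ⟨K₁ * K₂ * (48 * A * 3) * 2 + 1, by positivity, fun M hM ↦ ?_⟩
  set ℓ := Real.log M with hℓ
  have hℓ1 : 1 ≤ ℓ := one_le_log_of_three_le hM
  have hℓ0 : 0 < ℓ := by linarith
  have hM0 : 0 < M := by linarith
  set N := ⌊M⌋₊ with hN
  have hN1 : 1 ≤ N := Nat.le_floor (by norm_num; linarith)
  have hlogN : Real.log N ≤ ℓ := Real.log_le_log (by exact_mod_cast hN1) (Nat.floor_le hM0.le)
  have hlogN0 : 0 ≤ Real.log N := Real.log_natCast_nonneg N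
  set F : ℕ → ℝ := fun n ↦ (lam * ℓ - Real.log (M / n)) ^ q * S₁ M n * S₂ M n with hF
  have hgoal : |∑ c ∈ Icc 1 N, ∑ g ∈ Icc 1 (N / c), (μ g : ℝ) * c * Real.log g ^ t * (W (c * g) ^ 2 *
      ((lam * ℓ - Real.log (M / ((c * g : ℕ) : ℝ))) ^ q * S₁ M (c * g) * S₂ M (c * g)))| ≤
      (K₁ * K₂ * (48 * A * 3) * 2 + 1) * ℓ ^ (t + q + a₁ + a₂ + 1) := by
    refine (abs_selbergCollapse_logPow_le ht N F).trans ?_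
    have hterm : ∀ n ∈ Icc 1 N, |W n| * kappa n * |F n| ≤
        K₁ * K₂ * ℓ ^ (q + a₁ + a₂) * (1 + ℓ) * (kappa n * divWeight n ^ 2 / n) := by
      intro n hn
      have hn' := Finset.mem_Icc.1 hn
      have hn0 : n ≠ 0 := by omega
      have hnM : (n : ℝ) ≤ M := le_trans (by exact_mod_cast hn'.2) (Nat.floor_le hM0.le)
      have hD := divWeight_nonneg n
      have hκ := kappa_nonneg₇ n
      have hW := abs_W_le n
      have hκℓ : kappa n ≤ ℓ := by
        have h1 := kappa_le_log hn0
        have h2 : Real.log n ≤ ℓ := Real.log_le_log (by exact_mod_cast Nat.pos_of_ne_zero hn0) hnM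
        linarith
      have hB : |(lam * ℓ - Real.log (M / n)) ^ q| ≤ ℓ ^ q := by
        rw [abs_pow]; exact pow_le_pow_left₀ (abs_nonneg _) (abs_lam_mul_log_sub_log_div_le hlam0 hlam1 hM hn0 hnM) q
      have hS := mul_le_mul (hb₁ M hM n hn0 hnM) (hb₂ M hM n hn0 hnM) (abs_nonneg _) (by positivity)
      have hF' : |F n| ≤ ℓ ^ q * (K₁ * divWeight n * (1 + kappa n) * ℓ ^ a₁ *
          (K₂ * divWeight n * ℓ ^ a₂)) := by
        simp only [hF]
        rw [abs_mul, abs_mul, mul_assoc]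
        exact mul_le_mul hB hS (by positivity) (by positivity)
      have hn0' : (0 : ℝ) < n := by exact_mod_cast Nat.pos_of_ne_zero hn0
      have h1κ : 1 + kappa n ≤ 1 + ℓ := by linarith
      calc |W n| * kappa n * |F n|
          ≤ (n : ℝ)⁻¹ * kappa n * (ℓ ^ q * (K₁ * divWeight n * (1 + kappa n) * ℓ ^ a₁ *
              (K₂ * divWeight n * ℓ ^ a₂))) := by
            gcongr
        _ ≤ (n : ℝ)⁻¹ * kappa n * (ℓ ^ q * (K₁ * divWeight n * (1 + ℓ) * ℓ ^ a₁ *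
              (K₂ * divWeight n * ℓ ^ a₂))) := by
            gcongr
        _ = K₁ * K₂ * ℓ ^ (q + a₁ + a₂) * (1 + ℓ) * (kappa n * divWeight n ^ 2 / n) := by
            rw [pow_add, pow_add]
            field_simp
    have hsum : ∑ n ∈ Icc 1 N, |W n| * kappa n * |F n| ≤
        K₁ * K₂ * ℓ ^ (q + a₁ + a₂) * (1 + ℓ) * (48 * A * (3 * ℓ)) := by
      calc _ ≤ ∑ n ∈ Icc 1 N, K₁ * K₂ * ℓ ^ (q + a₁ + a₂) * (1 + ℓ) * (kappa n * divWeight n ^ 2 / n) :=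
            Finset.sum_le_sum hterm
        _ = K₁ * K₂ * ℓ ^ (q + a₁ + a₂) * (1 + ℓ) * ∑ n ∈ Icc 1 N, kappa n * divWeight n ^ 2 / n := by
            rw [Finset.mul_sum]
        _ ≤ K₁ * K₂ * ℓ ^ (q + a₁ + a₂) * (1 + ℓ) * (48 * A * (2 + Real.log N)) := by
            refine mul_le_mul_of_nonneg_left ?_ (by positivity)
            have := sum_kappa_divWeight_sq_div_le hN1
            rw [← hA] at this
            exact this
        _ ≤ K₁ * K₂ * ℓ ^ (q + a₁ + a₂) * (1 + ℓ) * (48 * A * (3 * ℓ)) := by gcongr; linarith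
    have hpow : Real.log N ^ (t - 1) ≤ ℓ ^ (t - 1) := pow_le_pow_left₀ hlogN0 hlogN _
    have hsum0 : 0 ≤ ∑ n ∈ Icc 1 N, |W n| * kappa n * |F n| :=
      Finset.sum_nonneg fun n _ ↦ by have := kappa_nonneg₇ n; positivity
    have h1ℓ : 1 + ℓ ≤ 2 * ℓ := by linarith
    calc Real.log N ^ (t - 1) * ∑ n ∈ Icc 1 N, |W n| * kappa n * |F n|
        ≤ ℓ ^ (t - 1) * (K₁ * K₂ * ℓ ^ (q + a₁ + a₂) * (1 + ℓ) * (48 * A * (3 * ℓ))) :=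
          mul_le_mul hpow hsum hsum0 (by positivity)
      _ ≤ ℓ ^ (t - 1) * (K₁ * K₂ * ℓ ^ (q + a₁ + a₂) * (2 * ℓ) * (48 * A * (3 * ℓ))) := by gcongr
      _ = K₁ * K₂ * (48 * A * 3) * 2 * ((ℓ ^ (t - 1) * ℓ) * ℓ ^ (q + a₁ + a₂) * ℓ) := by ring
      _ = K₁ * K₂ * (48 * A * 3) * 2 * ℓ ^ (t + q + a₁ + a₂ + 1) := by
          rw [pow_sub_one_mul (by omega : t ≠ 0) ℓ, show t + q + a₁ + a₂ + 1 = t + (q + a₁ + a₂) + 1 by ring,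
            pow_succ, pow_add ℓ t (q + a₁ + a₂)]
      _ ≤ (K₁ * K₂ * (48 * A * 3) * 2 + 1) * ℓ ^ (t + q + a₁ + a₂ + 1) := by gcongr; linarith
  exact hgoal

/-- **The `t = 0` piece of a shifted block with a `(1+κ)`-weighted crude coordinate and a plain crude coordinate is
`O(log^{q+a₁+a₂+1}M)`** (`Σ_{g∣n}μ(g)(n/g) = φ(n)`, `φ(n)W(n)² ≤ 1/n`). [cite: KowalskiMichelVanderKam2000, (23)–(28) — derivation] -/
theorem abs_collapseKappaCrude_zero_le {K₁ K₂ : ℝ} (hK₁ : 0 ≤ K₁) (hK₂ : 0 ≤ K₂)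
    (hb₁ : ∀ M : ℝ, 3 ≤ M → ∀ n : ℕ, n ≠ 0 → (n : ℝ) ≤ M →
      |S₁ M n| ≤ K₁ * divWeight n * (1 + kappa n) * Real.log M ^ a₁)
    (hb₂ : ∀ M : ℝ, 3 ≤ M → ∀ n : ℕ, n ≠ 0 → (n : ℝ) ≤ M →
      |S₂ M n| ≤ K₂ * divWeight n * Real.log M ^ a₂)
    (q : ℕ) {lam : ℝ} (hlam0 : 0 ≤ lam) (hlam1 : lam ≤ 1) :
    ∃ C : ℝ, 0 < C ∧ ∀ M : ℝ, 3 ≤ M →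
      |∑ c ∈ Icc 1 ⌊M⌋₊, ∑ g ∈ Icc 1 (⌊M⌋₊ / c), (μ g : ℝ) * c * Real.log g ^ 0 * (W (c * g) ^ 2 *
          ((lam * Real.log M - Real.log (M / ((c * g : ℕ) : ℝ))) ^ q * S₁ M (c * g) * S₂ M (c * g)))| ≤
        C * Real.log M ^ (q + a₁ + a₂ + 1) := by
  set A : ℝ := (∑' d : ℕ, (d : ℝ) ^ (-(5 / 4 : ℝ))) ^ 2 with hA
  have hA0 : 0 ≤ A := by positivity
  refine ⟨K₁ * K₂ * (49 * A * 3) + 1, by positivity, fun M hM ↦ ?_⟩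
  set ℓ := Real.log M with hℓ
  have hℓ1 : 1 ≤ ℓ := one_le_log_of_three_le hM
  have hℓ0 : 0 < ℓ := by linarith
  have hM0 : 0 < M := by linarith
  set N := ⌊M⌋₊ with hN
  have hN1 : 1 ≤ N := Nat.le_floor (by norm_num; linarith)
  have hlogN : Real.log N ≤ ℓ := Real.log_le_log (by exact_mod_cast hN1) (Nat.floor_le hM0.le)
  have hlogN0 : 0 ≤ Real.log N := Real.log_natCast_nonneg N
  set F : ℕ → ℝ := fun n ↦ (lam * ℓ - Real.log (M / n)) ^ q * S₁ M n * S₂ M n with hF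
  have hgoal : |∑ c ∈ Icc 1 N, ∑ g ∈ Icc 1 (N / c), (μ g : ℝ) * c * Real.log g ^ 0 * (W (c * g) ^ 2 *
      ((lam * ℓ - Real.log (M / ((c * g : ℕ) : ℝ))) ^ q * S₁ M (c * g) * S₂ M (c * g)))| ≤
      (K₁ * K₂ * (49 * A * 3) + 1) * ℓ ^ (q + a₁ + a₂ + 1) := by
    -- collapse `Σ_cΣ_g μ(g) c W(cg)² F(cg) = Σ_n φ(n) W(n)² F(n)`
    have hcol : ∑ c ∈ Icc 1 N, ∑ g ∈ Icc 1 (N / c), (μ g : ℝ) * c * Real.log g ^ 0 * (W (c * g) ^ 2 *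
        ((lam * ℓ - Real.log (M / ((c * g : ℕ) : ℝ))) ^ q * S₁ M (c * g) * S₂ M (c * g))) =
        ∑ n ∈ Icc 1 N, (Nat.totient n : ℝ) * W n ^ 2 * F n := by
      rw [sum_Icc_sum_Icc_div_eq_sum_sum_divisors N (fun c g ↦ (μ g : ℝ) * c * Real.log g ^ 0 * (W (c * g) ^ 2 *
        ((lam * ℓ - Real.log (M / ((c * g : ℕ) : ℝ))) ^ q * S₁ M (c * g) * S₂ M (c * g))))]
      refine Finset.sum_congr rfl fun n hn ↦ ?_
      have hn0 : n ≠ 0 := by have := (Finset.mem_Icc.1 hn).1; omega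
      have hterm : ∀ g ∈ n.divisors, (μ g : ℝ) * ((n / g : ℕ) : ℝ) * Real.log g ^ 0 *
          (W (n / g * g) ^ 2 * ((lam * ℓ - Real.log (M / ((n / g * g : ℕ) : ℝ))) ^ q * S₁ M (n / g * g) *
            S₂ M (n / g * g))) = (W n ^ 2 * F n) * ((μ g : ℝ) * ((n / g : ℕ) : ℝ)) := by
        intro g hg
        rw [Nat.div_mul_cancel (Nat.dvd_of_mem_divisors hg), pow_zero, mul_one]
        simp only [hF]
        ring
      rw [Finset.sum_congr rfl hterm, ← Finset.mul_sum, sum_divisors_moebius_mul_div_real hn0]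
      ring
    rw [hcol]
    have hterm : ∀ n ∈ Icc 1 N, |(Nat.totient n : ℝ) * W n ^ 2 * F n| ≤
        K₁ * K₂ * ℓ ^ (q + a₁ + a₂) * ((1 + kappa n) * divWeight n ^ 2 / n) := by
      intro n hn
      have hn' := Finset.mem_Icc.1 hn
      have hn0 : n ≠ 0 := by omega
      have hnM : (n : ℝ) ≤ M := le_trans (by exact_mod_cast hn'.2) (Nat.floor_le hM0.le)
      have hD := divWeight_nonneg n
      have hκ := kappa_nonneg₇ n
      have hφ := totient_mul_W_sq_le n
      have hφ0 : 0 ≤ (Nat.totient n : ℝ) * W n ^ 2 := by positivity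
      have hB : |(lam * ℓ - Real.log (M / n)) ^ q| ≤ ℓ ^ q := by
        rw [abs_pow]; exact pow_le_pow_left₀ (abs_nonneg _) (abs_lam_mul_log_sub_log_div_le hlam0 hlam1 hM hn0 hnM) q
      have hS := mul_le_mul (hb₁ M hM n hn0 hnM) (hb₂ M hM n hn0 hnM) (abs_nonneg _) (by positivity)
      have hF' : |F n| ≤ ℓ ^ q * (K₁ * divWeight n * (1 + kappa n) * ℓ ^ a₁ *
          (K₂ * divWeight n * ℓ ^ a₂)) := by
        simp only [hF]
        rw [abs_mul, abs_mul, mul_assoc]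
        exact mul_le_mul hB hS (by positivity) (by positivity)
      have hn0' : (0 : ℝ) < n := by exact_mod_cast Nat.pos_of_ne_zero hn0
      rw [abs_mul, abs_of_nonneg hφ0]
      calc (Nat.totient n : ℝ) * W n ^ 2 * |F n|
          ≤ (n : ℝ)⁻¹ * (ℓ ^ q * (K₁ * divWeight n * (1 + kappa n) * ℓ ^ a₁ *
              (K₂ * divWeight n * ℓ ^ a₂))) := mul_le_mul hφ hF' (abs_nonneg _) (by positivity)
        _ = K₁ * K₂ * ℓ ^ (q + a₁ + a₂) * ((1 + kappa n) * divWeight n ^ 2 / n) := by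
            rw [pow_add, pow_add]
            field_simp
    have hsum : ∑ n ∈ Icc 1 N, |(Nat.totient n : ℝ) * W n ^ 2 * F n| ≤
        K₁ * K₂ * ℓ ^ (q + a₁ + a₂) * (49 * A * (3 * ℓ)) := by
      calc _ ≤ ∑ n ∈ Icc 1 N, K₁ * K₂ * ℓ ^ (q + a₁ + a₂) * ((1 + kappa n) * divWeight n ^ 2 / n) :=
            Finset.sum_le_sum hterm
        _ = K₁ * K₂ * ℓ ^ (q + a₁ + a₂) *
              (∑ n ∈ Icc 1 N, divWeight n ^ 2 / n + ∑ n ∈ Icc 1 N, kappa n * divWeight n ^ 2 / n) := by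
            rw [← Finset.sum_add_distrib, Finset.mul_sum]
            exact Finset.sum_congr rfl fun n _ ↦ by ring
        _ ≤ K₁ * K₂ * ℓ ^ (q + a₁ + a₂) * (A * (2 + Real.log N) + 48 * A * (2 + Real.log N)) := by
            refine mul_le_mul_of_nonneg_left (add_le_add ?_ ?_) (by positivity)
            · have := sum_divWeight_sq_div_le hN1
              rw [← hA] at this
              exact this
            · have := sum_kappa_divWeight_sq_div_le hN1
              rw [← hA] at this
              exact this
        _ = K₁ * K₂ * ℓ ^ (q + a₁ + a₂) * (49 * A * (2 + Real.log N)) := by ring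
        _ ≤ K₁ * K₂ * ℓ ^ (q + a₁ + a₂) * (49 * A * (3 * ℓ)) := by gcongr; linarith
    calc _ ≤ ∑ n ∈ Icc 1 N, |(Nat.totient n : ℝ) * W n ^ 2 * F n| := Finset.abs_sum_le_sum_abs _ _
      _ ≤ K₁ * K₂ * ℓ ^ (q + a₁ + a₂) * (49 * A * (3 * ℓ)) := hsum
      _ = K₁ * K₂ * (49 * A * 3) * ℓ ^ (q + a₁ + a₂ + 1) := by
          rw [pow_succ]; ring
      _ ≤ (K₁ * K₂ * (49 * A * 3) + 1) * ℓ ^ (q + a₁ + a₂ + 1) := by gcongr; linarith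
  exact hgoal

/-- **Every `t`: the `(log g)^t` piece of a shifted block with a `(1+κ)`-weighted crude coordinate and a plain crude
coordinate is `O(log^{t+q+a₁+a₂+1}M)`** (`M ≥ 3`, `0 ≤ λ ≤ 1`). [cite: KowalskiMichelVanderKam2000, (23)–(28) — derivation] -/
theorem abs_collapseKappaCrude_le {K₁ K₂ : ℝ} (hK₁ : 0 ≤ K₁) (hK₂ : 0 ≤ K₂)
    (hb₁ : ∀ M : ℝ, 3 ≤ M → ∀ n : ℕ, n ≠ 0 → (n : ℝ) ≤ M →
      |S₁ M n| ≤ K₁ * divWeight n * (1 + kappa n) * Real.log M ^ a₁)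
    (hb₂ : ∀ M : ℝ, 3 ≤ M → ∀ n : ℕ, n ≠ 0 → (n : ℝ) ≤ M →
      |S₂ M n| ≤ K₂ * divWeight n * Real.log M ^ a₂)
    (t q : ℕ) {lam : ℝ} (hlam0 : 0 ≤ lam) (hlam1 : lam ≤ 1) :
    ∃ C : ℝ, 0 < C ∧ ∀ M : ℝ, 3 ≤ M →
      |∑ c ∈ Icc 1 ⌊M⌋₊, ∑ g ∈ Icc 1 (⌊M⌋₊ / c), (μ g : ℝ) * c * Real.log g ^ t * (W (c * g) ^ 2 *
          ((lam * Real.log M - Real.log (M / ((c * g : ℕ) : ℝ))) ^ q * S₁ M (c * g) * S₂ M (c * g)))| ≤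
        C * Real.log M ^ (t + q + a₁ + a₂ + 1) := by
  rcases Nat.eq_zero_or_pos t with ht0 | ht1
  · subst ht0
    obtain ⟨C, hC, h⟩ := abs_collapseKappaCrude_zero_le S₁ S₂ a₁ a₂ hK₁ hK₂ hb₁ hb₂ q hlam0 hlam1
    refine ⟨C, hC, fun M hM ↦ ?_⟩
    rw [show 0 + q + a₁ + a₂ + 1 = q + a₁ + a₂ + 1 by ring]
    exact h M hM
  · exact abs_collapseKappaCrude_logPow_le S₁ S₂ a₁ a₂ hK₁ hK₂ hb₁ hb₂ (show 1 ≤ t from ht1) q hlam0 hlam1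

end Summit.Parity.GeneralizedHardyLittlewood.Theorems.MomentsBeyondDiagonal.DiagKernel

end
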